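import Summits.QuantumFields.YangMills.Theorems.LuscherReductionTwistedTraceScalingBOProjection
import HarnessLib

/-!
# The Born–Oppenheimer projection with a SLOW-VARIABLE–ADAPTED fibre profile `Ω_u`: `P f = φ_f(u)·Ω_u(v)`, exact Pythagoras (MASS) — rate twin of lane A's `…BOProjection`
# (route `FlatTubeReduction`, crux K1 `NearFlatRatioLaw` stmt-QuantumFields-24720; seat `ym-line-ftr-p1` g9; R2b1 RECORD rung — no summit statement is proved here)

RED lane A's `…TwistedTraceScalingBOProjection` (p646539) builds the fibrewise `w`-orthogonal projection onto a FIXED (vacuum-frozen) fibre profile `Ω : LinkSpace L → ℝ` — enough at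
first order (COARSE-DESIGN §24.2).  The RATE twin (`RateTube.SoftTubeBORatePackageOn`, `Theorems/FlatTubeReductionSoftTubeRate.lean`) needs the `u`-ADAPTED profile
`Ω : GaugeConfig 3 1 SU2 → LinkSpace L → ℝ` (the frozen-`u` fibre ground state: g5 memo finding (A), `Cruxes/NearFlatRatioLaw/Lines/borate-fibredBO.md`), because freezing the
fibre at the vacuum costs first order in the slow amplitude.  THIS FILE is lane A's file VERBATIM with the extra slow argument (ns `…FemtoTransferGap.RateTube`):
* `boFunAd φ Ω U = 𝟙_{orthoTubeSet}(U)·φ(slowMean U)·Ω (slowMean U) (relLinkVec U)`; on the tube `= φ(u)·Ω u (linkEmbed v)` (`boFunAd_orthoTube`);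
* `fibreInnerAd w Ω f u = ∫ f(orthoTube u v)·Ω u v·w dπ(v)`, `fibreMassAd w Ω u = ∫ (Ω u v)²·w dπ(v)`, `boCoeffAd = 𝟙_𝒰·fibreInnerAd/fibreMassAd`, `boProjAd w Ω 𝒰 f = boFunAd (boCoeffAd f) Ω`;
* measurability (joint measurability of `uncurry Ω`) / boundedness / LINEARITY `boProjAd_sum`;
* ★★ `integral_boFunAd_mul_eq` (one-site disintegration + Fubini), ★★★ `tubeNormSq_boProjAd_add` (EXACT Pythagoras = MASS), ★ `fibreInnerAd_sub_boProjAd` (`f − Pf` fibrewise ⊥ `Ω_u`).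
No smallness, no `β`: pure measure theory on lane A's tube chart; the adapted profile's equivariance `Ω_{Ad_g u}(R_g v) = Ω_u(v)` (needed for the colour average, cf.
`…FibredBOEquivariant` p642962, lane A `colourAvg_boFun`) is the next file's business.
HONEST FRAMING: bookkeeping for the rate twin of a stub of a child of the CONDITIONAL reduction route R2b1; no spectral claim; not infinite volume, not a gap, not Clay.
Five new definitions (review-queued), no named facts, no `sorry`.
-/

set_option autoImplicit false

noncomputable section

open MeasureTheory Filter Topology Real
open scoped BigOperators
open Literature.MathematicalPhysics.QuantumFieldTheory
open Literature.MathematicalPhysics.QuantumLattice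

namespace Summit.QuantumFields.YangMills.Theorems.FemtoTransferGap.RateTube

open Summit.QuantumFields.YangMills.Theorems.FemtoTransferGap
open Summit.QuantumFields.YangMills.Theorems.FemtoTransferGap.TwoLattice.ConstTube
open Summit.QuantumFields.YangMills.Theorems.FemtoTransferGap.TwoLattice.Stiff (LinkSpace)

variable (L : ℕ) [NeZero L]

/-! ## §1 Born–Oppenheimer functions in the polar-mean chart -/

/-- **BO function** `boFunAd φ Ω U = 𝟙_{orthoTubeSet}(U)·φ(slowMean U)·Ω(relLinkVec U)`: slow amplitude × fibre profile, as a global function of the links. [cite: Luscher1983, §3] -/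
def boFunAd (φ : GaugeConfig 3 1 SU2 → ℝ) (Ω : GaugeConfig 3 1 SU2 → LinkSpace L → ℝ) : GaugeConfig 3 L SU2 → ℝ :=
  fun U => (orthoTubeSet L).indicator (fun _ => (1 : ℝ)) U * (φ (slowMean L U) * Ω (slowMean L U) (relLinkVec L U))

/-- On the tube: `boFunAd φ Ω (orthoTube u v) = φ(u)·Ω(v)`. [folklore] -/
theorem boFunAd_orthoTube (φ : GaugeConfig 3 1 SU2 → ℝ) (Ω : GaugeConfig 3 1 SU2 → LinkSpace L → ℝ) (u : GaugeConfig 3 1 SU2) {v : Edge 3 L → Fin 3 → ℝ} (hv : v ∈ capBalancedSet L) :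
    boFunAd L φ Ω (orthoTube L u v) = φ u * Ω u (linkEmbed L v) := by
  unfold boFunAd
  rw [Set.indicator_of_mem (orthoTube_mem L u hv), one_mul, slowMean_orthoTube L u hv, relLinkVec_orthoTube L u hv]

/-- Off the tube `boFunAd` vanishes. [folklore] -/
theorem boFunAd_eq_zero_of_not_mem (φ : GaugeConfig 3 1 SU2 → ℝ) (Ω : GaugeConfig 3 1 SU2 → LinkSpace L → ℝ) {U : GaugeConfig 3 L SU2} (hU : U ∉ orthoTubeSet L) : boFunAd L φ Ω U = 0 := by
  unfold boFunAd; rw [Set.indicator_of_notMem hU, zero_mul]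

/-- `boFunAd φ Ω` is measurable for measurable data. [folklore] -/
theorem measurable_boFunAd {φ : GaugeConfig 3 1 SU2 → ℝ} (hφ : Measurable φ) {Ω : GaugeConfig 3 1 SU2 → LinkSpace L → ℝ} (hΩ : Measurable (Function.uncurry Ω)) : Measurable (boFunAd L φ Ω) :=
  (measurable_const.indicator (measurableSet_orthoTubeSet L)).mul ((hφ.comp (measurable_slowMean L)).mul (hΩ.comp ((measurable_slowMean L).prodMk (measurable_relLinkVec L))))

/-- `|boFunAd φ Ω| ≤ Cφ·CΩ`. [folklore] -/
theorem abs_boFunAd_le {φ : GaugeConfig 3 1 SU2 → ℝ} {Cφ : ℝ} (hCφ : ∀ u, |φ u| ≤ Cφ) {Ω : GaugeConfig 3 1 SU2 → LinkSpace L → ℝ} {CΩ : ℝ} (hCΩ : ∀ u x, |Ω u x| ≤ CΩ) (U : GaugeConfig 3 L SU2) :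
    |boFunAd L φ Ω U| ≤ Cφ * CΩ := by
  have hCφ0 : 0 ≤ Cφ := (abs_nonneg _).trans (hCφ 1)
  have hprod : |φ (slowMean L U) * Ω (slowMean L U) (relLinkVec L U)| ≤ Cφ * CΩ := by
    rw [abs_mul]; exact mul_le_mul (hCφ _) (hCΩ _ _) (abs_nonneg _) hCφ0
  unfold boFunAd
  by_cases h : U ∈ orthoTubeSet L
  · rw [Set.indicator_of_mem h, one_mul]; exact hprod
  · rw [Set.indicator_of_notMem h, zero_mul, abs_zero]; exact (abs_nonneg _).trans hprod

/-! ## §2 Fibre integrals and the projection -/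

/-- The fibre pairing `∫ f(orthoTube u v)·Ω(v)·w(orthoTube u v) dπ(v)`. [folklore] -/
def fibreInnerAd (w : GaugeConfig 3 L SU2 → ℝ) (Ω : GaugeConfig 3 1 SU2 → LinkSpace L → ℝ) (f : GaugeConfig 3 L SU2 → ℝ) (u : GaugeConfig 3 1 SU2) : ℝ :=
  ∫ v, f (orthoTube L u v) * Ω u (linkEmbed L v) * w (orthoTube L u v) ∂orthoTransverse L

/-- The fibre mass `∫ Ω(v)²·w(orthoTube u v) dπ(v)`. [folklore] -/
def fibreMassAd (w : GaugeConfig 3 L SU2 → ℝ) (Ω : GaugeConfig 3 1 SU2 → LinkSpace L → ℝ) (u : GaugeConfig 3 1 SU2) : ℝ :=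
  ∫ v, Ω u (linkEmbed L v) ^ 2 * w (orthoTube L u v) ∂orthoTransverse L

/-- The BO slow coefficient of `f`: `𝟙_𝒰(u)·fibreInnerAd/fibreMassAd`. [cite: Luscher1983, §3] -/
def boCoeffAd (w : GaugeConfig 3 L SU2 → ℝ) (Ω : GaugeConfig 3 1 SU2 → LinkSpace L → ℝ) (𝒰 : Set (GaugeConfig 3 1 SU2)) (f : GaugeConfig 3 L SU2 → ℝ) : GaugeConfig 3 1 SU2 → ℝ :=
  𝒰.indicator fun u => fibreInnerAd L w Ω f u / fibreMassAd L w Ω u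

/-- ★ **The Born–Oppenheimer projection** `P f = boFunAd (boCoeffAd f) Ω`. [cite: Luscher1983, §3] [cite: SjostrandZworski2007, §2] -/
def boProjAd (w : GaugeConfig 3 L SU2 → ℝ) (Ω : GaugeConfig 3 1 SU2 → LinkSpace L → ℝ) (𝒰 : Set (GaugeConfig 3 1 SU2)) (f : GaugeConfig 3 L SU2 → ℝ) : GaugeConfig 3 L SU2 → ℝ :=
  boFunAd L (boCoeffAd L w Ω 𝒰 f) Ω

variable {L}

/-- The fibre integrand `v ↦ f(orthoTube u v)·Ω(v)·w(orthoTube u v)` is integrable (bounded measurable data). [folklore] -/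
theorem integrable_fibreIntegrandAd {w : GaugeConfig 3 L SU2 → ℝ} (hw : Measurable w) {Cw : ℝ} (hCw : ∀ U, |w U| ≤ Cw) {Ω : GaugeConfig 3 1 SU2 → LinkSpace L → ℝ} (hΩ : Measurable (Function.uncurry Ω)) {CΩ : ℝ}
    (hCΩ : ∀ u x, |Ω u x| ≤ CΩ) {f : GaugeConfig 3 L SU2 → ℝ} (hf : Measurable f) {Cf : ℝ} (hCf : ∀ U, |f U| ≤ Cf) (u : GaugeConfig 3 1 SU2) :
    Integrable (fun v => f (orthoTube L u v) * Ω u (linkEmbed L v) * w (orthoTube L u v)) (orthoTransverse L) := by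
  haveI := isFiniteMeasure_orthoTransverse L
  have hCf0 : 0 ≤ Cf := (abs_nonneg _).trans (hCf 1)
  have hCΩ0 : 0 ≤ CΩ := (abs_nonneg _).trans (hCΩ 1 0)
  exact integrable_of_measurable_abs_le _ (((hf.comp (measurable_orthoTube_right u)).mul (hΩ.comp (measurable_const.prodMk (measurable_linkEmbed L)))).mul (hw.comp (measurable_orthoTube_right u)))
    (C := Cf * CΩ * Cw) fun v => by
      rw [abs_mul, abs_mul]; exact mul_le_mul (mul_le_mul (hCf _) (hCΩ _ _) (abs_nonneg _) hCf0) (hCw _) (abs_nonneg _) (mul_nonneg hCf0 hCΩ0)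

/-- The fibre pairing is a measurable function of the slow variable. [folklore] -/
theorem measurable_fibreInnerAd {w : GaugeConfig 3 L SU2 → ℝ} (hw : Measurable w) {Ω : GaugeConfig 3 1 SU2 → LinkSpace L → ℝ} (hΩ : Measurable (Function.uncurry Ω)) {f : GaugeConfig 3 L SU2 → ℝ} (hf : Measurable f) :
    Measurable (fibreInnerAd L w Ω f) := by
  haveI := isFiniteMeasure_orthoTransverse L
  have hJ : Measurable fun p : GaugeConfig 3 1 SU2 × (Edge 3 L → Fin 3 → ℝ) => f (orthoTube L p.1 p.2) * Ω p.1 (linkEmbed L p.2) * w (orthoTube L p.1 p.2) :=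
    ((measurable_comp_orthoTube hf).mul (hΩ.comp (measurable_fst.prodMk ((measurable_linkEmbed L).comp measurable_snd)))).mul (measurable_comp_orthoTube hw)
  exact (hJ.stronglyMeasurable.integral_prod_right' (ν := orthoTransverse L)).measurable

/-- The fibre mass is a measurable function of the slow variable. [folklore] -/
theorem measurable_fibreMassAd {w : GaugeConfig 3 L SU2 → ℝ} (hw : Measurable w) {Ω : GaugeConfig 3 1 SU2 → LinkSpace L → ℝ} (hΩ : Measurable (Function.uncurry Ω)) : Measurable (fibreMassAd L w Ω) := by
  haveI := isFiniteMeasure_orthoTransverse L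
  have hJ : Measurable fun p : GaugeConfig 3 1 SU2 × (Edge 3 L → Fin 3 → ℝ) => Ω p.1 (linkEmbed L p.2) ^ 2 * w (orthoTube L p.1 p.2) :=
    ((hΩ.comp (measurable_fst.prodMk ((measurable_linkEmbed L).comp measurable_snd))).pow_const 2).mul (measurable_comp_orthoTube hw)
  exact (hJ.stronglyMeasurable.integral_prod_right' (ν := orthoTransverse L)).measurable

/-- `|fibreInnerAd| ≤ Cf·CΩ·Cw·π(univ)`. [folklore] -/
theorem abs_fibreInnerAd_le {w : GaugeConfig 3 L SU2 → ℝ} {Cw : ℝ} (hCw : ∀ U, |w U| ≤ Cw) {Ω : GaugeConfig 3 1 SU2 → LinkSpace L → ℝ} {CΩ : ℝ} (hCΩ : ∀ u x, |Ω u x| ≤ CΩ)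
    {f : GaugeConfig 3 L SU2 → ℝ} {Cf : ℝ} (hCf : ∀ U, |f U| ≤ Cf) (u : GaugeConfig 3 1 SU2) :
    |fibreInnerAd L w Ω f u| ≤ Cf * CΩ * Cw * (orthoTransverse L).real Set.univ := by
  haveI := isFiniteMeasure_orthoTransverse L
  have hCf0 : 0 ≤ Cf := (abs_nonneg _).trans (hCf 1)
  have hCΩ0 : 0 ≤ CΩ := (abs_nonneg _).trans (hCΩ 1 0)
  unfold fibreInnerAd
  calc |∫ v, f (orthoTube L u v) * Ω u (linkEmbed L v) * w (orthoTube L u v) ∂orthoTransverse L|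
      ≤ ∫ v, |f (orthoTube L u v) * Ω u (linkEmbed L v) * w (orthoTube L u v)| ∂orthoTransverse L := abs_integral_le_integral_abs
    _ ≤ ∫ _v, Cf * CΩ * Cw ∂orthoTransverse L := by
        refine integral_mono_of_nonneg (ae_of_all _ fun v => abs_nonneg _) (integrable_const _) (ae_of_all _ fun v => ?_)
        show |f (orthoTube L u v) * Ω u (linkEmbed L v) * w (orthoTube L u v)| ≤ Cf * CΩ * Cw
        rw [abs_mul, abs_mul]
        exact mul_le_mul (mul_le_mul (hCf _) (hCΩ _ _) (abs_nonneg _) hCf0) (hCw _) (abs_nonneg _) (by positivity)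
    _ = Cf * CΩ * Cw * (orthoTransverse L).real Set.univ := by rw [integral_const, smul_eq_mul, mul_comm]

/-- `boCoeffAd` is measurable. [folklore] -/
theorem measurable_boCoeffAd {w : GaugeConfig 3 L SU2 → ℝ} (hw : Measurable w) {Ω : GaugeConfig 3 1 SU2 → LinkSpace L → ℝ} (hΩ : Measurable (Function.uncurry Ω)) {𝒰 : Set (GaugeConfig 3 1 SU2)} (h𝒰 : MeasurableSet 𝒰)
    {f : GaugeConfig 3 L SU2 → ℝ} (hf : Measurable f) : Measurable (boCoeffAd L w Ω 𝒰 f) :=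
  ((measurable_fibreInnerAd hw hΩ hf).div (measurable_fibreMassAd hw hΩ)).indicator h𝒰

/-- `|boCoeffAd| ≤ Cf·CΩ·Cw·π(univ)/Z₀` when `fibreMassAd ≥ Z₀ > 0` on `𝒰`. [folklore] -/
theorem abs_boCoeffAd_le {w : GaugeConfig 3 L SU2 → ℝ} {Cw : ℝ} (hCw : ∀ U, |w U| ≤ Cw) {Ω : GaugeConfig 3 1 SU2 → LinkSpace L → ℝ} {CΩ : ℝ} (hCΩ : ∀ u x, |Ω u x| ≤ CΩ) {𝒰 : Set (GaugeConfig 3 1 SU2)}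
    {Z₀ : ℝ} (hZ₀ : 0 < Z₀) (hZ : ∀ u ∈ 𝒰, Z₀ ≤ fibreMassAd L w Ω u) {f : GaugeConfig 3 L SU2 → ℝ} {Cf : ℝ} (hCf : ∀ U, |f U| ≤ Cf) (u : GaugeConfig 3 1 SU2) :
    |boCoeffAd L w Ω 𝒰 f u| ≤ Cf * CΩ * Cw * (orthoTransverse L).real Set.univ / Z₀ := by
  have hnum := abs_fibreInnerAd_le hCw hCΩ hCf u
  have hnum0 : 0 ≤ Cf * CΩ * Cw * (orthoTransverse L).real Set.univ := (abs_nonneg _).trans hnum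
  unfold boCoeffAd
  by_cases hu : u ∈ 𝒰
  · rw [Set.indicator_of_mem hu, abs_div, abs_of_pos (hZ₀.trans_le (hZ u hu))]
    exact div_le_div₀ hnum0 hnum hZ₀ (hZ u hu)
  · rw [Set.indicator_of_notMem hu, abs_zero]; positivity

/-- ★ LINEARITY: `boCoeffAd (Σ aᵢ fᵢ) = Σ aᵢ boCoeffAd fᵢ` (bounded measurable `fᵢ`). [folklore] -/
theorem boCoeffAd_sum {w : GaugeConfig 3 L SU2 → ℝ} (hw : Measurable w) {Cw : ℝ} (hCw : ∀ U, |w U| ≤ Cw) {Ω : GaugeConfig 3 1 SU2 → LinkSpace L → ℝ} (hΩ : Measurable (Function.uncurry Ω)) {CΩ : ℝ}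
    (hCΩ : ∀ u x, |Ω u x| ≤ CΩ) (𝒰 : Set (GaugeConfig 3 1 SU2)) {k : ℕ} (a : Fin k → ℝ) {f : Fin k → GaugeConfig 3 L SU2 → ℝ} (hf : ∀ i, Measurable (f i))
    (hfb : ∀ i, ∃ C : ℝ, ∀ U, |f i U| ≤ C) (u : GaugeConfig 3 1 SU2) :
    boCoeffAd L w Ω 𝒰 (fun U => ∑ i, a i * f i U) u = ∑ i, a i * boCoeffAd L w Ω 𝒰 (f i) u := by
  haveI := isFiniteMeasure_orthoTransverse L
  have hlin : fibreInnerAd L w Ω (fun U => ∑ i, a i * f i U) u = ∑ i, a i * fibreInnerAd L w Ω (f i) u := by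
    unfold fibreInnerAd
    have hint : ∀ i, Integrable (fun v => f i (orthoTube L u v) * Ω u (linkEmbed L v) * w (orthoTube L u v)) (orthoTransverse L) := fun i => by
      obtain ⟨C, hC⟩ := hfb i
      exact integrable_fibreIntegrandAd hw hCw hΩ hCΩ (hf i) hC u
    calc ∫ v, (∑ i, a i * f i (orthoTube L u v)) * Ω u (linkEmbed L v) * w (orthoTube L u v) ∂orthoTransverse L
        = ∫ v, ∑ i, a i * (f i (orthoTube L u v) * Ω u (linkEmbed L v) * w (orthoTube L u v)) ∂orthoTransverse L := by
          refine integral_congr_ae (ae_of_all _ fun v => ?_)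
          dsimp only
          rw [Finset.sum_mul, Finset.sum_mul]
          exact Finset.sum_congr rfl fun i _ => by ring
      _ = ∑ i, ∫ v, a i * (f i (orthoTube L u v) * Ω u (linkEmbed L v) * w (orthoTube L u v)) ∂orthoTransverse L :=
          integral_finsetSum _ fun i _ => (hint i).const_mul (a i)
      _ = ∑ i, a i * ∫ v, f i (orthoTube L u v) * Ω u (linkEmbed L v) * w (orthoTube L u v) ∂orthoTransverse L :=
          Finset.sum_congr rfl fun i _ => integral_const_mul _ _
  unfold boCoeffAd
  by_cases hu : u ∈ 𝒰
  · simp only [Set.indicator_of_mem hu, hlin, Finset.sum_div, mul_div_assoc]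
  · simp only [Set.indicator_of_notMem hu, mul_zero, Finset.sum_const_zero]

/-- ★ LINEARITY of the projection: `boProjAd (Σ aᵢ fᵢ) = Σ aᵢ boProjAd fᵢ` pointwise. [folklore] -/
theorem boProjAd_sum {w : GaugeConfig 3 L SU2 → ℝ} (hw : Measurable w) {Cw : ℝ} (hCw : ∀ U, |w U| ≤ Cw) {Ω : GaugeConfig 3 1 SU2 → LinkSpace L → ℝ} (hΩ : Measurable (Function.uncurry Ω)) {CΩ : ℝ}
    (hCΩ : ∀ u x, |Ω u x| ≤ CΩ) (𝒰 : Set (GaugeConfig 3 1 SU2)) {k : ℕ} (a : Fin k → ℝ) {f : Fin k → GaugeConfig 3 L SU2 → ℝ} (hf : ∀ i, Measurable (f i))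
    (hfb : ∀ i, ∃ C : ℝ, ∀ U, |f i U| ≤ C) (U : GaugeConfig 3 L SU2) :
    boProjAd L w Ω 𝒰 (fun V => ∑ i, a i * f i V) U = ∑ i, a i * boProjAd L w Ω 𝒰 (f i) U := by
  unfold boProjAd boFunAd
  rw [boCoeffAd_sum hw hCw hΩ hCΩ 𝒰 a hf hfb]
  simp only [Finset.sum_mul, Finset.mul_sum]
  exact Finset.sum_congr rfl fun i _ => by ring

/-! ## §3 ★★ The one-site disintegration of pairings with BO functions -/

/-- ★★ **`∫ boFunAd φ Ω · g · w = ∫ φ(u)·fibreInnerAd w Ω g u du`** (bounded measurable data): exact one-site disintegration on the orthographic tube followed by Fubini.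
[cite: Luscher1983, §3] -/
theorem integral_boFunAd_mul_eq {φ : GaugeConfig 3 1 SU2 → ℝ} (hφ : Measurable φ) {Cφ : ℝ} (hCφ : ∀ u, |φ u| ≤ Cφ) {Ω : GaugeConfig 3 1 SU2 → LinkSpace L → ℝ} (hΩ : Measurable (Function.uncurry Ω)) {CΩ : ℝ}
    (hCΩ : ∀ u x, |Ω u x| ≤ CΩ) {g w : GaugeConfig 3 L SU2 → ℝ} (hg : Measurable g) {Cg : ℝ} (hCg : ∀ U, |g U| ≤ Cg) (hw : Measurable w) {Cw : ℝ} (hCw : ∀ U, |w U| ≤ Cw) :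
    ∫ U, boFunAd L φ Ω U * g U * w U ∂configMeasure SU2 L = ∫ u, φ u * fibreInnerAd L w Ω g u ∂configMeasure SU2 1 := by
  haveI := isFiniteMeasure_orthoTransverse L
  have hCφ0 : 0 ≤ Cφ := (abs_nonneg _).trans (hCφ 1)
  have hCΩ0 : 0 ≤ CΩ := (abs_nonneg _).trans (hCΩ 1 0)
  have hCg0 : 0 ≤ Cg := (abs_nonneg _).trans (hCg 1)
  -- Step 1: disintegrate
  have hFm : Measurable fun U => boFunAd L φ Ω U * g U * w U := ((measurable_boFunAd L hφ hΩ).mul hg).mul hw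
  have hFb : ∀ U, |boFunAd L φ Ω U * g U * w U| ≤ Cφ * CΩ * Cg * Cw := fun U => by
    rw [abs_mul, abs_mul]
    exact mul_le_mul (mul_le_mul (abs_boFunAd_le L hCφ hCΩ U) (hCg U) (abs_nonneg _) (by positivity)) (hCw U) (abs_nonneg _) (by positivity)
  have hF0 : ∀ U, U ∉ orthoTubeSet L → boFunAd L φ Ω U * g U * w U = 0 := fun U hU => by rw [boFunAd_eq_zero_of_not_mem L φ Ω hU, zero_mul, zero_mul]
  rw [integral_configMeasure_orthoTube L hFm ⟨_, hFb⟩ hF0]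
  -- Step 2: rewrite the integrand on the tube (a.e. in `v`: the transverse measure is carried by the cap)
  have hae : ∀ᵐ v ∂orthoTransverse L, v ∈ capBalancedSet L := by
    rw [ae_iff]
    exact orthoTransverse_compl_capBalancedSet L
  have h1 : ∫ v, ∫ u, boFunAd L φ Ω (orthoTube L u v) * g (orthoTube L u v) * w (orthoTube L u v) ∂configMeasure SU2 1 ∂orthoTransverse L =
      ∫ v, ∫ u, φ u * (g (orthoTube L u v) * Ω u (linkEmbed L v) * w (orthoTube L u v)) ∂configMeasure SU2 1 ∂orthoTransverse L := by
    refine integral_congr_ae (hae.mono fun v hv => ?_)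
    refine integral_congr_ae (ae_of_all _ fun u => ?_)
    dsimp only
    rw [boFunAd_orthoTube L φ Ω u hv]; ring
  rw [h1]
  -- Step 3: Fubini (bounded measurable integrand on a product of finite measures)
  have hGm : Measurable (Function.uncurry fun (v : Edge 3 L → Fin 3 → ℝ) (u : GaugeConfig 3 1 SU2) =>
      φ u * (g (orthoTube L u v) * Ω u (linkEmbed L v) * w (orthoTube L u v))) := by
    have hO : Measurable fun p : (Edge 3 L → Fin 3 → ℝ) × GaugeConfig 3 1 SU2 => orthoTube L p.2 p.1 := by
      haveI : SecondCountableTopology SU2 := secondCountableTopology_su2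
      refine measurable_pi_lambda _ fun e => ?_
      simp only [orthoTube]
      exact (continuous_chartSU2.measurable.comp ((measurable_pi_apply e).comp measurable_fst)).mul ((measurable_pi_apply _).comp measurable_snd)
    exact (hφ.comp measurable_snd).mul (((hg.comp hO).mul (hΩ.comp (measurable_snd.prodMk ((measurable_linkEmbed L).comp measurable_fst)))).mul (hw.comp hO))
  have hGb : ∀ p : (Edge 3 L → Fin 3 → ℝ) × GaugeConfig 3 1 SU2,
      |(Function.uncurry fun (v : Edge 3 L → Fin 3 → ℝ) (u : GaugeConfig 3 1 SU2) => φ u * (g (orthoTube L u v) * Ω u (linkEmbed L v) * w (orthoTube L u v))) p| ≤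
        Cφ * (Cg * CΩ * Cw) := fun p => by
    simp only [Function.uncurry]
    rw [abs_mul]
    have hin : |g (orthoTube L p.2 p.1) * Ω p.2 (linkEmbed L p.1) * w (orthoTube L p.2 p.1)| ≤ Cg * CΩ * Cw := by
      rw [abs_mul, abs_mul]
      exact mul_le_mul (mul_le_mul (hCg _) (hCΩ _ _) (abs_nonneg _) hCg0) (hCw _) (abs_nonneg _) (by positivity)
    exact mul_le_mul (hCφ _) hin (abs_nonneg _) hCφ0
  have hint := integrable_of_measurable_abs_le ((orthoTransverse L).prod (configMeasure SU2 1)) hGm hGb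
  rw [integral_integral_swap hint]
  -- Step 4: pull `φ u` out of the fibre integral
  refine integral_congr_ae (ae_of_all _ fun u => ?_)
  dsimp only
  unfold fibreInnerAd
  exact integral_const_mul _ _

/-! ## §4 ★★★ Exact Pythagoras for the projection -/

/-- `⟨Pf, g⟩_w = ∫ boCoeffAd f · fibreInnerAd g`. [folklore] -/
theorem integral_boProjAd_mul {w : GaugeConfig 3 L SU2 → ℝ} (hw : Measurable w) {Cw : ℝ} (hCw : ∀ U, |w U| ≤ Cw) {Ω : GaugeConfig 3 1 SU2 → LinkSpace L → ℝ} (hΩ : Measurable (Function.uncurry Ω)) {CΩ : ℝ}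
    (hCΩ : ∀ u x, |Ω u x| ≤ CΩ) {𝒰 : Set (GaugeConfig 3 1 SU2)} (h𝒰 : MeasurableSet 𝒰) {Z₀ : ℝ} (hZ₀ : 0 < Z₀) (hZ : ∀ u ∈ 𝒰, Z₀ ≤ fibreMassAd L w Ω u)
    {f g : GaugeConfig 3 L SU2 → ℝ} (hf : Measurable f) {Cf : ℝ} (hCf : ∀ U, |f U| ≤ Cf) (hg : Measurable g) {Cg : ℝ} (hCg : ∀ U, |g U| ≤ Cg) :
    ∫ U, boProjAd L w Ω 𝒰 f U * g U * w U ∂configMeasure SU2 L = ∫ u, boCoeffAd L w Ω 𝒰 f u * fibreInnerAd L w Ω g u ∂configMeasure SU2 1 :=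
  integral_boFunAd_mul_eq (measurable_boCoeffAd hw hΩ h𝒰 hf) (abs_boCoeffAd_le hCw hCΩ hZ₀ hZ hCf) hΩ hCΩ hg hCg hw hCw

/-- The fibre pairing of a BO function with itself-type data: `fibreInnerAd w Ω (boFunAd φ Ω) u = φ u · fibreMassAd w Ω u`. [folklore] -/
theorem fibreInnerAd_boFunAd {w : GaugeConfig 3 L SU2 → ℝ} (φ : GaugeConfig 3 1 SU2 → ℝ) (Ω : GaugeConfig 3 1 SU2 → LinkSpace L → ℝ) (u : GaugeConfig 3 1 SU2) :
    fibreInnerAd L w Ω (boFunAd L φ Ω) u = φ u * fibreMassAd L w Ω u := by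
  haveI := isFiniteMeasure_orthoTransverse L
  unfold fibreInnerAd fibreMassAd
  rw [← integral_const_mul]
  have hae : ∀ᵐ v ∂orthoTransverse L, v ∈ capBalancedSet L := by rw [ae_iff]; exact orthoTransverse_compl_capBalancedSet L
  refine integral_congr_ae (hae.mono fun v hv => ?_)
  show boFunAd L φ Ω (orthoTube L u v) * Ω u (linkEmbed L v) * w (orthoTube L u v) = φ u * (Ω u (linkEmbed L v) ^ 2 * w (orthoTube L u v))
  rw [boFunAd_orthoTube L φ Ω u hv]; ring

/-- ★★ `⟨Pf, f⟩_w = ⟨Pf, Pf⟩_w` — the projection property. [folklore] -/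
theorem integral_boProjAd_mul_self_eq {w : GaugeConfig 3 L SU2 → ℝ} (hw : Measurable w) {Cw : ℝ} (hCw : ∀ U, |w U| ≤ Cw) {Ω : GaugeConfig 3 1 SU2 → LinkSpace L → ℝ} (hΩ : Measurable (Function.uncurry Ω)) {CΩ : ℝ}
    (hCΩ : ∀ u x, |Ω u x| ≤ CΩ) {𝒰 : Set (GaugeConfig 3 1 SU2)} (h𝒰 : MeasurableSet 𝒰) {Z₀ : ℝ} (hZ₀ : 0 < Z₀) (hZ : ∀ u ∈ 𝒰, Z₀ ≤ fibreMassAd L w Ω u)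
    {f : GaugeConfig 3 L SU2 → ℝ} (hf : Measurable f) {Cf : ℝ} (hCf : ∀ U, |f U| ≤ Cf) :
    ∫ U, boProjAd L w Ω 𝒰 f U * f U * w U ∂configMeasure SU2 L = ∫ U, boProjAd L w Ω 𝒰 f U * boProjAd L w Ω 𝒰 f U * w U ∂configMeasure SU2 L := by
  have hPm : Measurable (boProjAd L w Ω 𝒰 f) := measurable_boFunAd L (measurable_boCoeffAd hw hΩ h𝒰 hf) hΩ
  have hPb := abs_boFunAd_le L (abs_boCoeffAd_le hCw hCΩ hZ₀ hZ hCf) hCΩ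
  rw [integral_boProjAd_mul hw hCw hΩ hCΩ h𝒰 hZ₀ hZ hf hCf hf hCf, integral_boProjAd_mul hw hCw hΩ hCΩ h𝒰 hZ₀ hZ hf hCf hPm hPb]
  refine integral_congr_ae (ae_of_all _ fun u => ?_)
  dsimp only
  unfold boProjAd
  rw [fibreInnerAd_boFunAd]
  -- `c · I = c · (c · Z)` with `c = 𝟙_𝒰 I/Z`
  unfold boCoeffAd
  by_cases hu : u ∈ 𝒰
  · rw [Set.indicator_of_mem hu]
    have hZu : fibreMassAd L w Ω u ≠ 0 := (hZ₀.trans_le (hZ u hu)).ne'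
    field_simp
  · rw [Set.indicator_of_notMem hu, zero_mul, zero_mul]

/-- ★★★ **EXACT PYTHAGORAS (the MASS clause)**: `tubeNormSq w (Pf) + tubeNormSq w (f − Pf) = tubeNormSq w f` for bounded measurable `f`, `w`, `Ω`, measurable `𝒰` with
`fibreMassAd ≥ Z₀ > 0` on `𝒰`. [cite: SjostrandZworski2007, §2] -/
theorem tubeNormSq_boProjAd_add {w : GaugeConfig 3 L SU2 → ℝ} (hw : Measurable w) {Cw : ℝ} (hCw : ∀ U, |w U| ≤ Cw) {Ω : GaugeConfig 3 1 SU2 → LinkSpace L → ℝ} (hΩ : Measurable (Function.uncurry Ω)) {CΩ : ℝ}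
    (hCΩ : ∀ u x, |Ω u x| ≤ CΩ) {𝒰 : Set (GaugeConfig 3 1 SU2)} (h𝒰 : MeasurableSet 𝒰) {Z₀ : ℝ} (hZ₀ : 0 < Z₀) (hZ : ∀ u ∈ 𝒰, Z₀ ≤ fibreMassAd L w Ω u)
    {f : GaugeConfig 3 L SU2 → ℝ} (hf : Measurable f) {Cf : ℝ} (hCf : ∀ U, |f U| ≤ Cf) :
    tubeNormSq w (boProjAd L w Ω 𝒰 f) + tubeNormSq w (fun U => f U - boProjAd L w Ω 𝒰 f U) = tubeNormSq w f := by
  have hPm : Measurable (boProjAd L w Ω 𝒰 f) := measurable_boFunAd L (measurable_boCoeffAd hw hΩ h𝒰 hf) hΩ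
  obtain hPb := abs_boFunAd_le L (abs_boCoeffAd_le hCw hCΩ hZ₀ hZ hCf) hCΩ
  set P := boProjAd L w Ω 𝒰 f with hPdef
  set CP : ℝ := Cf * CΩ * Cw * (orthoTransverse L).real Set.univ / Z₀ * CΩ with hCP
  have hCf0 : 0 ≤ Cf := (abs_nonneg _).trans (hCf 1)
  have hCP0 : 0 ≤ CP := (abs_nonneg _).trans (hPb 1)
  have hkey := integral_boProjAd_mul_self_eq hw hCw hΩ hCΩ h𝒰 hZ₀ hZ hf hCf
  -- integrability of the three products
  have hiPP : Integrable (fun U => P U * P U * w U) (configMeasure SU2 L) :=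
    integrable_of_measurable_abs_le _ ((hPm.mul hPm).mul hw) (C := CP * CP * Cw) fun U => by
      rw [abs_mul, abs_mul]; exact mul_le_mul (mul_le_mul (hPb U) (hPb U) (abs_nonneg _) hCP0) (hCw U) (abs_nonneg _) (by positivity)
  have hiPf : Integrable (fun U => P U * f U * w U) (configMeasure SU2 L) :=
    integrable_of_measurable_abs_le _ ((hPm.mul hf).mul hw) (C := CP * Cf * Cw) fun U => by
      rw [abs_mul, abs_mul]; exact mul_le_mul (mul_le_mul (hPb U) (hCf U) (abs_nonneg _) hCP0) (hCw U) (abs_nonneg _) (by positivity)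
  have hiff : Integrable (fun U => f U * f U * w U) (configMeasure SU2 L) :=
    integrable_of_measurable_abs_le _ ((hf.mul hf).mul hw) (C := Cf * Cf * Cw) fun U => by
      rw [abs_mul, abs_mul]; exact mul_le_mul (mul_le_mul (hCf U) (hCf U) (abs_nonneg _) hCf0) (hCw U) (abs_nonneg _) (by positivity)
  unfold tubeNormSq
  have e1 : (fun U => P U ^ 2 * w U) = fun U => P U * P U * w U := by funext U; ring
  have e2 : (fun U => (f U - P U) ^ 2 * w U) = fun U => f U * f U * w U - 2 * (P U * f U * w U) + P U * P U * w U := by funext U; ring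
  have e3 : (fun U => f U ^ 2 * w U) = fun U => f U * f U * w U := by funext U; ring
  have hcm : Integrable (fun U => 2 * (P U * f U * w U)) (configMeasure SU2 L) := hiPf.const_mul 2
  have hsub : Integrable (fun U => f U * f U * w U - 2 * (P U * f U * w U)) (configMeasure SU2 L) := hiff.sub hcm
  rw [e1, e2, e3, integral_add hsub hiPP, integral_sub hiff hcm, integral_const_mul, hkey]
  ring

/-- ★ The remainder `v = f − Pf` is fibrewise `w`-orthogonal to `Ω` over `𝒰`: `fibreInnerAd w Ω (f − Pf) u = 0` for `u ∈ 𝒰`. [folklore] -/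
theorem fibreInnerAd_sub_boProjAd {w : GaugeConfig 3 L SU2 → ℝ} (hw : Measurable w) {Cw : ℝ} (hCw : ∀ U, |w U| ≤ Cw) {Ω : GaugeConfig 3 1 SU2 → LinkSpace L → ℝ} (hΩ : Measurable (Function.uncurry Ω)) {CΩ : ℝ}
    (hCΩ : ∀ u x, |Ω u x| ≤ CΩ) {𝒰 : Set (GaugeConfig 3 1 SU2)} (h𝒰 : MeasurableSet 𝒰) {Z₀ : ℝ} (hZ₀ : 0 < Z₀) (hZ : ∀ u ∈ 𝒰, Z₀ ≤ fibreMassAd L w Ω u)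
    {f : GaugeConfig 3 L SU2 → ℝ} (hf : Measurable f) {Cf : ℝ} (hCf : ∀ U, |f U| ≤ Cf) {u : GaugeConfig 3 1 SU2} (hu : u ∈ 𝒰) :
    fibreInnerAd L w Ω (fun U => f U - boProjAd L w Ω 𝒰 f U) u = 0 := by
  have hPm : Measurable (boProjAd L w Ω 𝒰 f) := measurable_boFunAd L (measurable_boCoeffAd hw hΩ h𝒰 hf) hΩ
  have hPb := abs_boFunAd_le L (abs_boCoeffAd_le hCw hCΩ hZ₀ hZ hCf) hCΩ
  have h1 := integrable_fibreIntegrandAd hw hCw hΩ hCΩ hf hCf u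
  have h2 := integrable_fibreIntegrandAd hw hCw hΩ hCΩ hPm hPb u
  have hsub : fibreInnerAd L w Ω (fun U => f U - boProjAd L w Ω 𝒰 f U) u = fibreInnerAd L w Ω f u - fibreInnerAd L w Ω (boProjAd L w Ω 𝒰 f) u := by
    unfold fibreInnerAd
    rw [← integral_sub h1 h2]
    refine integral_congr_ae (ae_of_all _ fun v => ?_)
    dsimp only; ring
  rw [hsub]
  unfold boProjAd
  rw [fibreInnerAd_boFunAd]
  unfold boCoeffAd
  rw [Set.indicator_of_mem hu, div_mul_cancel₀ _ (hZ₀.trans_le (hZ u hu)).ne', sub_self]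

end Summit.QuantumFields.YangMills.Theorems.FemtoTransferGap.RateTube

end
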